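import Literature.NumberTheory.ModularForms.SiegelHalfSpaceTwoAction
import Literature.NumberTheory.ModularForms.SiegelThetaGenusTwo
import HarnessLib

/-!
# `Sp₄`-invariance on the Siegel half space of degree 2: the form `P_Z`, the theta function, and
# the symplectic volume

Stages 2b–2c of the bottom-up proof of Siegel's volume formula
`Literature.NumberTheory.ModularForms.Siegel1943_vol_F2` (`vol(F₂) = π³/270`; [cite: Klingen1990,
Ch. I §3, closing remark]), continuing `SiegelHalfSpaceTwoAction.lean` (the action
`x ↦ g • x = ofZ ((AZ+B)(CZ+D)⁻¹)` of `Sp₄(ℝ)` on `U = H₂ ⊂ ℝ⁶`) and `SiegelThetaGenusTwo.lean`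
(`P_Z`, `θ_Z`). Everything is PROVED (no named facts):

* `pFormC`, `pFormC_smul`, `pFormS_smul` — the positive form `P_Z[(a; b)] = ℓ^* Y⁻¹ ℓ`,
  `ℓ = a - Zb` (`= Y⁻¹[a - Xb] + Y[b]` for real `a, b`, `pFormC_real`; this is Klingen's positive
  symplectic matrix `s(z)` of I.3 (5)) and its **transformation law `P_{g⟨Z⟩}[w] = P_Z[g⁻¹ w]`**
  (Klingen I.3 (6)), from `ℓ_Z(g⁻¹ w) = Qᵀ ℓ_{g⟨Z⟩}(w)` and `Im g⟨Z⟩ = Q⁻ᵀ Y Q̄⁻¹`.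
* `toR : Sp₄(ℤ) →* Sp₄(ℝ)` and **`siegelTheta_smul`: `θ_{γ⟨Z⟩}(s) = θ_Z(s)` for `γ ∈ Sp₄(ℤ)`**.
* `hasFDerivAt_smulVec` — `x ↦ g • x` is differentiable on `H₂` with derivative
  `h ↦ ofZ (Q⁻ᵀ Z(h) Q⁻¹)` (Klingen I.1 (5)), via `A - g⟨Z⟩C = Q⁻ᵀ` and the derivative of the
  matrix inverse (`hasFDerivAt_ringInverse`); `det_derivL` — **its Jacobian determinant is
  `|det(CZ + D)|⁻⁶`** (the complex determinant of `H ↦ RᵀHR` on `Sym₂(ℂ)` is `(det R)³`,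
  `det_symSq`; real determinant `= |·|²` by `LinearMap.det_restrictScalars`).
* `siegelVolume` — the symplectic volume `dv = dx dy / det y³` on `↥U`, and
  **`instSMulInvariantMeasureU : SMulInvariantMeasure Sp₄(ℝ) ↥U siegelVolume`** (change of
  variables `MeasureTheory.lintegral_image_eq_lintegral_abs_det_fderiv_mul`, as for Mathlib's
  `UpperHalfPlane` volume, together with `det Y(g⟨Z⟩) = det Y / |det(CZ+D)|²`).

## References

* H. Klingen, *Introductory Lectures on Siegel Modular Forms*, CUP 1990, Ch. I §1 (5)–(7) and
  §3 (5)–(6). [Klingen1990]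
-/

noncomputable section

namespace Literature.NumberTheory.ModularForms.Sp4Covolume

open Complex Matrix

variable (g : Sp4R) {x : Fin 6 → ℝ}

/-! ### The positive form `P_Z` and its transformation law -/

/-- `(g⟨Z⟩)₁₀ = (g⟨Z⟩)₀₁`. [folklore] -/
theorem smulZ_one_zero (hx : x ∈ U) : smulZ g x 1 0 = smulZ g x 0 1 := by
  have := congrFun (congrFun (smulZ_transpose g hx) 0) 1
  simpa using this

/-- `toYc (g • x)` is the (complexified) imaginary part of `g⟨Z⟩`. [folklore] -/
theorem toYc_smulVec (hx : x ∈ U) :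
    toYc (smulVec g x) = ((smulZ g x).map Complex.im).map ((↑) : ℝ → ℂ) := by
  ext i j
  fin_cases i <;> fin_cases j <;> simp [toYc, smulVec, ofZ, smulZ_one_zero g hx]

/-- **`Im g⟨Z⟩ = Q⁻ᵀ Y Q̄⁻¹`** in the form `Qᵀ · Im g⟨Z⟩ · Q̄ = Y` (Klingen (6)). [folklore] -/
theorem transpose_matQ_mul_toYc_smulVec (hx : x ∈ U) :
    (matQ g x)ᵀ * toYc (smulVec g x) * (matQ g x).map (starRingEnd ℂ) = toYc x := by
  have h := transpose_matQ_mul_sub_conj g hx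
  rw [sub_map_conj_eq, ← toYc_smulVec g hx, Matrix.mul_smul, Matrix.smul_mul] at h
  have h2I : (2 * I : ℂ) ≠ 0 := mul_ne_zero two_ne_zero Complex.I_ne_zero
  exact smul_right_injective _ h2I h

/-- `det Y` as a complex number. [folklore] -/
theorem det_toYc (x : Fin 6 → ℝ) : (toYc x).det = ((x 3 * x 5 - x 4 ^ 2 : ℝ) : ℂ) := by
  rw [toYc, Matrix.det_fin_two_of]; push_cast; ring

/-- `det Y ≠ 0` on `H₂`. [folklore] -/
theorem isUnit_det_toYc (hx : x ∈ U) : IsUnit (toYc x).det := by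
  rw [det_toYc, isUnit_iff_ne_zero, Complex.ofReal_ne_zero]
  have := hx.2; linarith

/-- `adj(Y) · Y = det(Y) · 1`. [folklore] -/
theorem adj_mul_toYc (x : Fin 6 → ℝ) :
    !![(x 5 : ℂ), -x 4; -x 4, x 3] * toYc x =
      ((x 3 * x 5 - x 4 ^ 2 : ℝ) : ℂ) • (1 : Matrix (Fin 2) (Fin 2) ℂ) := by
  ext i j
  fin_cases i <;> fin_cases j <;> simp [Matrix.mul_apply, Fin.sum_univ_two, toYc] <;> ring

/-- The explicit inverse of `Y`. [folklore] -/
theorem toYc_inv (hx : x ∈ U) :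
    (toYc x)⁻¹ = ((x 3 * x 5 - x 4 ^ 2 : ℝ) : ℂ)⁻¹ • !![(x 5 : ℂ), -x 4; -x 4, x 3] := by
  have hD : ((x 3 * x 5 - x 4 ^ 2 : ℝ) : ℂ) ≠ 0 := by
    rw [Complex.ofReal_ne_zero]; have := hx.2; linarith
  apply Matrix.inv_eq_left_inv
  rw [Matrix.smul_mul, adj_mul_toYc, smul_smul, inv_mul_cancel₀ hD, one_smul]

/-- **`(Im g⟨Z⟩)⁻¹ = Q̄ Y⁻¹ Qᵀ`.** [folklore] -/
theorem toYc_smulVec_inv (hx : x ∈ U) :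
    (toYc (smulVec g x))⁻¹ = (matQ g x).map (starRingEnd ℂ) * (toYc x)⁻¹ * (matQ g x)ᵀ := by
  have huT : IsUnit ((matQ g x)ᵀ).det := by rw [det_transpose]; exact isUnit_det_matQ g hx
  have h := transpose_matQ_mul_toYc_smulVec g hx
  -- Y' Q̄ = Q⁻ᵀ Y
  have h1 : toYc (smulVec g x) * (matQ g x).map (starRingEnd ℂ) = ((matQ g x)ᵀ)⁻¹ * toYc x := by
    rw [← h, ← Matrix.mul_assoc, ← Matrix.mul_assoc, Matrix.nonsing_inv_mul _ huT, Matrix.one_mul]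
  apply Matrix.inv_eq_right_inv
  rw [← Matrix.mul_assoc, ← Matrix.mul_assoc, h1, Matrix.mul_assoc ((matQ g x)ᵀ)⁻¹,
    Matrix.mul_nonsing_inv _ (isUnit_det_toYc hx), Matrix.mul_one, Matrix.nonsing_inv_mul _ huT]

/-- `ℓ_Z(a, b) = a - Z b`. [folklore] -/
def ell (x : Fin 6 → ℝ) (a b : Fin 2 → ℂ) : Fin 2 → ℂ := a - toZ x *ᵥ b

/-- The positive form of `P_Z` on `ℂ² × ℂ²`: `P_Z[(a; b)] = ℓ^* Y⁻¹ ℓ`, `ℓ = a - Zb`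
(for real `a, b` this is `Y⁻¹[a - Xb] + Y[b]`, Klingen I.3 (5)). [folklore] -/
def pFormC (x : Fin 6 → ℝ) (a b : Fin 2 → ℂ) : ℂ := star (ell x a b) ⬝ᵥ ((toYc x)⁻¹ *ᵥ ell x a b)

/-- **Transformation of `ℓ`**: with `(a'; b') = g⁻¹ (a; b) = (Dᵀa - Bᵀb; -Cᵀa + Aᵀb)`,
`ℓ_Z(a', b') = Qᵀ ℓ_{g⟨Z⟩}(a, b)`. [folklore] -/
theorem ell_transform (hx : x ∈ U) (a b : Fin 2 → ℂ) :
    ell x ((cD g)ᵀ *ᵥ a - (cB g)ᵀ *ᵥ b) (-((cC g)ᵀ *ᵥ a) + (cA g)ᵀ *ᵥ b) =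
      (matQ g x)ᵀ *ᵥ ell (smulVec g x) a b := by
  have huT : IsUnit ((matQ g x)ᵀ).det := by rw [det_transpose]; exact isUnit_det_matQ g hx
  have hW : (matQ g x)ᵀ * smulZ g x = (matP g x)ᵀ := by
    rw [smulZ_eq_transpose_form g hx, ← Matrix.mul_assoc, Matrix.mul_nonsing_inv _ huT, Matrix.one_mul]
  unfold ell
  rw [toZ_smulVec g hx, Matrix.mulVec_sub, Matrix.mulVec_mulVec, hW]
  simp only [matP, matQ, transpose_add, transpose_mul, toZ_transpose, Matrix.add_mulVec,
    ← Matrix.mulVec_mulVec, Matrix.mulVec_add, Matrix.mulVec_neg]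
  abel

/-- `ū ⬝ (M w) = conj-adjoint identity`: `star u ⬝ᵥ (M *ᵥ w) = star (Mᴴ *ᵥ u) ⬝ᵥ w`. [folklore] -/
theorem star_dotProduct_mulVec (u w : Fin 2 → ℂ) (M : Matrix (Fin 2) (Fin 2) ℂ) :
    star u ⬝ᵥ (M *ᵥ w) = star (Mᴴ *ᵥ u) ⬝ᵥ w := by
  rw [Matrix.star_mulVec, Matrix.conjTranspose_conjTranspose, Matrix.dotProduct_mulVec]

/-- **The transformation law of `P_Z`** (Klingen I.3 (6): `s(g⟨z⟩) = s(z)[g⁻¹]`):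
`P_{g⟨Z⟩}[(a; b)] = P_Z[g⁻¹(a; b)]`. [cite: Klingen1990, Ch. I §3 (6)] -/
theorem pFormC_smul (hx : x ∈ U) (a b : Fin 2 → ℂ) :
    pFormC (smulVec g x) a b =
      pFormC x ((cD g)ᵀ *ᵥ a - (cB g)ᵀ *ᵥ b) (-((cC g)ᵀ *ᵥ a) + (cA g)ᵀ *ᵥ b) := by
  unfold pFormC
  rw [ell_transform g hx, toYc_smulVec_inv g hx, ← Matrix.mulVec_mulVec, ← Matrix.mulVec_mulVec,
    star_dotProduct_mulVec _ _ ((matQ g x).map (starRingEnd ℂ))]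
  congr 2
  -- (Q̄)ᴴ = Qᵀ
  ext i
  simp [Matrix.conjTranspose_apply, Matrix.map_apply]

/-- `ℓ` for real `a, b` in coordinates: `ℓ = (a - Xb) - i Yb`. [folklore] -/
theorem ell_real (x : Fin 6 → ℝ) (a₀ a₁ b₀ b₁ : ℝ) :
    ell x ![(a₀ : ℂ), a₁] ![(b₀ : ℂ), b₁] =
      ![((a₀ - (x 0 * b₀ + x 1 * b₁) : ℝ) : ℂ) - ((x 3 * b₀ + x 4 * b₁ : ℝ) : ℂ) * I,
        ((a₁ - (x 1 * b₀ + x 2 * b₁) : ℝ) : ℂ) - ((x 4 * b₀ + x 5 * b₁ : ℝ) : ℂ) * I] := by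
  unfold ell toZ
  ext i
  fin_cases i <;> simp <;> ring

/-- `ℓ̄ᵀ A ℓ = A[u] + A[w]` for a real symmetric `A` and `ℓ = u - iw`. [folklore] -/
theorem star_quad_real (a c d u₁ u₂ w₁ w₂ : ℝ) :
    star ![(u₁ : ℂ) - (w₁ : ℂ) * I, (u₂ : ℂ) - (w₂ : ℂ) * I] ⬝ᵥ
        (!![(a : ℂ), c; c, d] *ᵥ ![(u₁ : ℂ) - (w₁ : ℂ) * I, (u₂ : ℂ) - (w₂ : ℂ) * I]) =
      ((a * u₁ ^ 2 + 2 * c * u₁ * u₂ + d * u₂ ^ 2 + (a * w₁ ^ 2 + 2 * c * w₁ * w₂ + d * w₂ ^ 2) : ℝ) : ℂ) := by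
  simp [Matrix.mulVec, dotProduct, Fin.sum_univ_two, Complex.conj_ofReal]
  linear_combination (-(a * w₁ ^ 2 + 2 * c * w₁ * w₂ + d * w₂ ^ 2 : ℂ)) * Complex.I_sq

/-- **`P_Z` in coordinates**: for real `a, b`,
`P_Z[(a; b)] = Y⁻¹[a - Xb] + Y[b]` (the formula `Sp4Covolume.pForm` of `SiegelThetaGenusTwo`). [folklore] -/
theorem pFormC_real (hx : x ∈ U) (a₀ a₁ b₀ b₁ : ℝ) :
    pFormC x ![(a₀ : ℂ), a₁] ![(b₀ : ℂ), b₁] =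
      (((x 5 * (a₀ - (x 0 * b₀ + x 1 * b₁)) ^ 2 - 2 * x 4 * (a₀ - (x 0 * b₀ + x 1 * b₁)) *
          (a₁ - (x 1 * b₀ + x 2 * b₁)) + x 3 * (a₁ - (x 1 * b₀ + x 2 * b₁)) ^ 2) / (x 3 * x 5 - x 4 ^ 2) +
        (x 3 * b₀ ^ 2 + 2 * x 4 * b₀ * b₁ + x 5 * b₁ ^ 2) : ℝ) : ℂ) := by
  have hD : x 3 * x 5 - x 4 ^ 2 ≠ 0 := by have := hx.2; linarith
  unfold pFormC
  rw [toYc_inv hx, Matrix.smul_mulVec, dotProduct_smul, smul_eq_mul, ell_real,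
    show (!![(x 5 : ℂ), -x 4; -x 4, x 3] : Matrix (Fin 2) (Fin 2) ℂ) =
      !![((x 5 : ℝ) : ℂ), ((-x 4 : ℝ) : ℂ); ((-x 4 : ℝ) : ℂ), ((x 3 : ℝ) : ℂ)] by push_cast; rfl,
    star_quad_real, ← Complex.ofReal_inv, ← Complex.ofReal_mul]
  congr 1
  field_simp
  ring

/-! ### The transformation law on `ℂ⁴` and on the integer lattice; `θ_Z` is `Sp₄(ℤ)`-invariant -/

/-- Blocks of `g⁻¹ = (Dᵀ -Bᵀ; -Cᵀ Aᵀ)`. [folklore] -/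
theorem blk_inv :
    blkA g⁻¹ = (blkD g)ᵀ ∧ blkB g⁻¹ = -(blkB g)ᵀ ∧ blkC g⁻¹ = -(blkC g)ᵀ ∧ blkD g⁻¹ = (blkA g)ᵀ := by
  have h : ((g⁻¹ : Sp4R) : Matrix (Fin 2 ⊕ Fin 2) (Fin 2 ⊕ Fin 2) ℝ) =
      -Matrix.J (Fin 2) ℝ * (g : Matrix (Fin 2 ⊕ Fin 2) (Fin 2 ⊕ Fin 2) ℝ)ᵀ * Matrix.J (Fin 2) ℝ :=
    SymplecticGroup.coe_inv g
  conv_lhs at h => rw [← fromBlocks_blk g⁻¹]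
  conv_rhs at h => rw [← fromBlocks_blk g]
  simp only [Matrix.J, fromBlocks_transpose, fromBlocks_neg, fromBlocks_multiply, neg_zero, neg_neg,
    Matrix.zero_mul, Matrix.one_mul, Matrix.neg_mul, zero_add, add_zero, Matrix.mul_zero,
    Matrix.mul_one, Matrix.mul_neg, neg_neg] at h
  obtain ⟨h1, h2, h3, h4⟩ := Matrix.fromBlocks_inj.1 h
  exact ⟨h1, h2, h3, h4⟩

/-- Complexified blocks of `g⁻¹`. [folklore] -/
theorem c_inv :
    cA g⁻¹ = (cD g)ᵀ ∧ cB g⁻¹ = -(cB g)ᵀ ∧ cC g⁻¹ = -(cC g)ᵀ ∧ cD g⁻¹ = (cA g)ᵀ := by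
  obtain ⟨h1, h2, h3, h4⟩ := blk_inv g
  refine ⟨?_, ?_, ?_, ?_⟩
  · unfold cA cD; rw [h1, Matrix.transpose_map]
  · unfold cB; rw [h2]; ext i j; simp
  · unfold cC; rw [h3]; ext i j; simp
  · unfold cD cA; rw [h4, Matrix.transpose_map]

/-- The positive form on `ℂ⁴ = ℂ² × ℂ²`. [folklore] -/
def pFormS (x : Fin 6 → ℝ) (w : Fin 2 ⊕ Fin 2 → ℂ) : ℂ :=
  pFormC x (fun i => w (Sum.inl i)) (fun i => w (Sum.inr i))

/-- **`P_{g⟨Z⟩}[w] = P_Z[g⁻¹ w]`** on `ℂ⁴`. [cite: Klingen1990, Ch. I §3 (6)] -/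
theorem pFormS_smul (hx : x ∈ U) (w : Fin 2 ⊕ Fin 2 → ℂ) :
    pFormS (smulVec g x) w = pFormS x (gc g⁻¹ *ᵥ w) := by
  obtain ⟨h1, h2, h3, h4⟩ := c_inv g
  unfold pFormS
  rw [pFormC_smul g hx, gc_eq_fromBlocks, h1, h2, h3, h4]
  have ew : w = Sum.elim (fun i => w (Sum.inl i)) (fun i => w (Sum.inr i)) := by
    ext (i | i) <;> rfl
  conv_rhs => rw [ew, fromBlocks_mulVec]
  simp only [Sum.elim_inl, Sum.elim_inr]
  congr 1 <;> (ext i; fin_cases i <;> simp <;> ring)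

/-- `Sp₄(ℤ)`. [folklore] -/
abbrev Sp4Z := Matrix.symplecticGroup (Fin 2) ℤ

/-- The inclusion `Sp₄(ℤ) →* Sp₄(ℝ)`. [folklore] -/
def toR : Sp4Z →* Sp4R where
  toFun γ := ⟨(γ : Matrix (Fin 2 ⊕ Fin 2) (Fin 2 ⊕ Fin 2) ℤ).map (Int.castRingHom ℝ),
    SymplecticGroup.map_mem γ.2 (Int.castRingHom ℝ)⟩
  map_one' := by
    apply Subtype.ext
    simp only [OneMemClass.coe_one]
    exact Matrix.map_one _ (map_zero _) (map_one _)
  map_mul' a b := by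
    apply Subtype.ext
    simp only [Submonoid.coe_mul]
    exact Matrix.map_mul

/-- The matrix of `toR γ`. [folklore] -/
theorem coe_toR (γ : Sp4Z) :
    ((toR γ : Sp4R) : Matrix (Fin 2 ⊕ Fin 2) (Fin 2 ⊕ Fin 2) ℝ) =
      (γ : Matrix (Fin 2 ⊕ Fin 2) (Fin 2 ⊕ Fin 2) ℤ).map (Int.castRingHom ℝ) := rfl

/-- The complexified matrix of `γ⁻¹` applied to an integral vector is integral:
`gc (toR γ)⁻¹ · w = γ⁻¹ · w`. [folklore] -/
theorem gc_toR_inv_mulVec (γ : Sp4Z) (u : Fin 2 ⊕ Fin 2 → ℤ) :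
    gc (toR γ)⁻¹ *ᵥ (fun i => ((u i : ℤ) : ℂ)) =
      fun i => ((((γ⁻¹ : Sp4Z) : Matrix (Fin 2 ⊕ Fin 2) (Fin 2 ⊕ Fin 2) ℤ) *ᵥ u) i : ℂ) := by
  rw [← map_inv, gc, coe_toR, Matrix.map_map]
  have hf : ((↑) : ℝ → ℂ) ∘ ⇑(Int.castRingHom ℝ) = ⇑(Int.castRingHom ℂ) := by
    ext n; simp
  rw [hf]
  ext i
  exact (RingHom.map_mulVec (Int.castRingHom ℂ)
    ((γ⁻¹ : Sp4Z) : Matrix (Fin 2 ⊕ Fin 2) (Fin 2 ⊕ Fin 2) ℤ) u i).symm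

/-- `Sp₄(ℤ)` acts on `ℤ⁴` by `γ · u`. [folklore] -/
instance instMulActionSp4ZVec : MulAction Sp4Z (Fin 2 ⊕ Fin 2 → ℤ) where
  smul γ u := (γ : Matrix (Fin 2 ⊕ Fin 2) (Fin 2 ⊕ Fin 2) ℤ) *ᵥ u
  one_smul u := by
    show ((1 : Sp4Z) : Matrix (Fin 2 ⊕ Fin 2) (Fin 2 ⊕ Fin 2) ℤ) *ᵥ u = u
    rw [OneMemClass.coe_one, Matrix.one_mulVec]
  mul_smul γ γ' u := by
    show ((γ * γ' : Sp4Z) : Matrix (Fin 2 ⊕ Fin 2) (Fin 2 ⊕ Fin 2) ℤ) *ᵥ u =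
      (γ : Matrix (Fin 2 ⊕ Fin 2) (Fin 2 ⊕ Fin 2) ℤ) *ᵥ
        ((γ' : Matrix (Fin 2 ⊕ Fin 2) (Fin 2 ⊕ Fin 2) ℤ) *ᵥ u)
    rw [Submonoid.coe_mul, Matrix.mulVec_mulVec]

/-- The action of `Sp₄(ℤ)` on `ℤ⁴` is `γ · u`. [folklore] -/
theorem sp4Z_smul_def (γ : Sp4Z) (u : Fin 2 ⊕ Fin 2 → ℤ) :
    γ • u = (γ : Matrix (Fin 2 ⊕ Fin 2) (Fin 2 ⊕ Fin 2) ℤ) *ᵥ u := rfl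

/-- The index equivalence `Fin 4 ≃ Fin 2 ⊕ Fin 2` used to view `v : ℤ⁴` as `(a; b)`. [folklore] -/
def idx : (Fin 2 ⊕ Fin 2 → ℤ) ≃ (Fin 4 → ℤ) := Equiv.arrowCongr finSumFinEquiv (Equiv.refl ℤ)

/-- `idx` in coordinates. [folklore] -/
theorem idx_apply (u : Fin 2 ⊕ Fin 2 → ℤ) :
    idx u = ![u (Sum.inl 0), u (Sum.inl 1), u (Sum.inr 0), u (Sum.inr 1)] := by
  ext i
  fin_cases i <;> rfl

/-- **Bridge to `Sp4Covolume.pForm`**: for an integral vector,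
`pForm x v = Re P_Z[(a; b)]` with `(a; b) = v` through `idx`. [folklore] -/
theorem pForm_eq_re_pFormS (hx : x ∈ U) (u : Fin 2 ⊕ Fin 2 → ℤ) :
    pForm x (idx u) =
      (pFormS x (fun i => ((u i : ℤ) : ℂ))).re := by
  have h := pFormC_real hx (u (Sum.inl 0)) (u (Sum.inl 1)) (u (Sum.inr 0)) (u (Sum.inr 1))
  have e1 : (fun i => ((u (Sum.inl i) : ℤ) : ℂ)) = ![((u (Sum.inl 0) : ℝ) : ℂ), ((u (Sum.inl 1) : ℝ) : ℂ)] := by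
    ext i; fin_cases i <;> simp
  have e2 : (fun i => ((u (Sum.inr i) : ℤ) : ℂ)) = ![((u (Sum.inr 0) : ℝ) : ℂ), ((u (Sum.inr 1) : ℝ) : ℂ)] := by
    ext i; fin_cases i <;> simp
  unfold pFormS
  rw [e1, e2, h, Complex.ofReal_re, idx_apply]
  simp only [pForm,
    yInvForm,
    yForm,
    detY,
    Matrix.cons_val_zero, Matrix.cons_val_one, Matrix.cons_val]

/-- **`θ_Z` is `Sp₄(ℤ)`-invariant**: `θ_{γ⟨Z⟩}(s) = θ_Z(s)` (`P_{γZ} = P_Z[γ⁻¹]` and `γ⁻¹` permutes `ℤ⁴`).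
[cite: Klingen1990, Ch. I §3 (6)] -/
theorem siegelTheta_smul (γ : Sp4Z) (hx : x ∈ U) (s : ℝ) :
    siegelTheta (smulVec (toR γ) x) s =
      siegelTheta x s := by
  unfold siegelTheta
  rw [← idx.tsum_eq, ← idx.tsum_eq]
  have hxg : smulVec (toR γ) x ∈ U := smulVec_mem_U _ hx
  simp_rw [pForm_eq_re_pFormS hxg, pForm_eq_re_pFormS hx, pFormS_smul (toR γ) hx, gc_toR_inv_mulVec]
  -- reindex by the permutation `u ↦ γ⁻¹ • u` of `ℤ⁴`
  exact (MulAction.toPerm (γ⁻¹ : Sp4Z)).tsum_eq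
    (fun u : Fin 2 ⊕ Fin 2 → ℤ => Real.exp (-Real.pi * s * (pFormS x fun i => ((u i : ℤ) : ℂ)).re))

/-! ### The derivative of the action and its Jacobian determinant -/

section Deriv

attribute [local instance] Matrix.linftyOpNormedAddCommGroup Matrix.linftyOpNormedSpace
  Matrix.linftyOpNormedRing Matrix.linftyOpNormedAlgebra

/-- `toZ` as an `ℝ`-linear map. [folklore] -/
def toZL : (Fin 6 → ℝ) →L[ℝ] Matrix (Fin 2) (Fin 2) ℂ :=
  LinearMap.toContinuousLinearMap
    { toFun := toZ
      map_add' := fun x y => by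
        ext i j; fin_cases i <;> fin_cases j <;> simp [toZ] <;> ring
      map_smul' := fun c x => by
        ext i j; fin_cases i <;> fin_cases j <;> simp [toZ] <;> ring }

/-- `toZL` is `toZ`. [folklore] -/
@[simp] theorem toZL_apply (h : Fin 6 → ℝ) : toZL h = toZ h := rfl

/-- `ofZ` as an `ℝ`-linear map. [folklore] -/
def ofZL : Matrix (Fin 2) (Fin 2) ℂ →L[ℝ] (Fin 6 → ℝ) :=
  LinearMap.toContinuousLinearMap
    { toFun := ofZ
      map_add' := fun W W' => by
        ext i; fin_cases i <;> simp [ofZ]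
      map_smul' := fun c W => by
        ext i; fin_cases i <;> simp [ofZ] }

/-- `ofZL` is `ofZ`. [folklore] -/
@[simp] theorem ofZL_apply (W : Matrix (Fin 2) (Fin 2) ℂ) : ofZL W = ofZ W := rfl

/-- `x ↦ P = A·Z(x) + B` has derivative `h ↦ A·Z(h)`. [folklore] -/
theorem hasFDerivAt_matP (x : Fin 6 → ℝ) :
    HasFDerivAt (matP g) ((ContinuousLinearMap.mul ℝ (Matrix (Fin 2) (Fin 2) ℂ) (cA g)).comp toZL) x := by
  have h1 : HasFDerivAt (fun y : Fin 6 → ℝ => cA g * toZ y)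
      ((ContinuousLinearMap.mul ℝ (Matrix (Fin 2) (Fin 2) ℂ) (cA g)).comp toZL) x := by
    have := toZL.hasFDerivAt (x := x)
    exact ((ContinuousLinearMap.mul ℝ (Matrix (Fin 2) (Fin 2) ℂ) (cA g)).hasFDerivAt).comp x this
  have h2 := h1.add_const (cB g)
  exact h2

/-- `x ↦ Q = C·Z(x) + D` has derivative `h ↦ C·Z(h)`. [folklore] -/
theorem hasFDerivAt_matQ (x : Fin 6 → ℝ) :
    HasFDerivAt (matQ g) ((ContinuousLinearMap.mul ℝ (Matrix (Fin 2) (Fin 2) ℂ) (cC g)).comp toZL) x := by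
  have h1 : HasFDerivAt (fun y : Fin 6 → ℝ => cC g * toZ y)
      ((ContinuousLinearMap.mul ℝ (Matrix (Fin 2) (Fin 2) ℂ) (cC g)).comp toZL) x := by
    have := toZL.hasFDerivAt (x := x)
    exact ((ContinuousLinearMap.mul ℝ (Matrix (Fin 2) (Fin 2) ℂ) (cC g)).hasFDerivAt).comp x this
  exact h1.add_const (cD g)

/-- `x ↦ Q(x)⁻¹` is differentiable on `H₂` with derivative `h ↦ -Q⁻¹ (C Z(h)) Q⁻¹`. [folklore] -/
theorem hasFDerivAt_matQ_inv (hx : x ∈ U) :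
    HasFDerivAt (fun y => (matQ g y)⁻¹)
      ((-ContinuousLinearMap.mulLeftRight ℝ (Matrix (Fin 2) (Fin 2) ℂ) (matQ g x)⁻¹ (matQ g x)⁻¹).comp
        ((ContinuousLinearMap.mul ℝ (Matrix (Fin 2) (Fin 2) ℂ) (cC g)).comp toZL)) x := by
  have hu : IsUnit (matQ g x) := (Matrix.isUnit_iff_isUnit_det _).2 (isUnit_det_matQ g hx)
  obtain ⟨u, hu'⟩ := hu
  have hinv : HasFDerivAt Ring.inverse
      (-ContinuousLinearMap.mulLeftRight ℝ (Matrix (Fin 2) (Fin 2) ℂ) (↑u⁻¹) (↑u⁻¹)) (matQ g x) := by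
    rw [← hu']; exact hasFDerivAt_ringInverse u
  have hcomp := hinv.comp x (hasFDerivAt_matQ g x)
  have e1 : (fun y => (matQ g y)⁻¹) = Ring.inverse ∘ matQ g := by
    ext y : 1; exact Matrix.nonsing_inv_eq_ringInverse _
  have e2 : (↑u⁻¹ : Matrix (Fin 2) (Fin 2) ℂ) = (matQ g x)⁻¹ := by
    rw [← hu']; exact Matrix.coe_units_inv u
  rw [e1]
  rw [e2] at hcomp
  exact hcomp

/-- **`A - g⟨Z⟩ C = Q⁻ᵀ`** (the identity behind Klingen's (5)). [folklore] -/
theorem cA_sub_smulZ_mul_cC (hx : x ∈ U) : cA g - smulZ g x * cC g = ((matQ g x)ᵀ)⁻¹ := by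
  obtain ⟨h1, -, -⟩ := c_rel g
  have h3' := c_rel' g
  have huT : IsUnit ((matQ g x)ᵀ).det := by rw [det_transpose]; exact isUnit_det_matQ g hx
  have hW : (matQ g x)ᵀ * smulZ g x = (matP g x)ᵀ := by
    rw [smulZ_eq_transpose_form g hx, ← Matrix.mul_assoc, Matrix.mul_nonsing_inv _ huT, Matrix.one_mul]
  have key : (matQ g x)ᵀ * (cA g - smulZ g x * cC g) = 1 := by
    rw [Matrix.mul_sub, ← Matrix.mul_assoc, hW]
    have : (matQ g x)ᵀ * cA g - (matP g x)ᵀ * cC g =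
        toZ x * ((cC g)ᵀ * cA g - (cA g)ᵀ * cC g) + ((cD g)ᵀ * cA g - (cB g)ᵀ * cC g) := by
      simp only [matP, matQ, transpose_add, transpose_mul, toZ_transpose]
      noncomm_ring
    rw [this, h1, sub_self, Matrix.mul_zero, zero_add, h3']
  calc cA g - smulZ g x * cC g = ((matQ g x)ᵀ)⁻¹ * ((matQ g x)ᵀ * (cA g - smulZ g x * cC g)) := by
        rw [← Matrix.mul_assoc, Matrix.nonsing_inv_mul _ huT, Matrix.one_mul]
    _ = ((matQ g x)ᵀ)⁻¹ := by rw [key, Matrix.mul_one]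

/-- The derivative of `x ↦ g • x` at `x ∈ H₂`: `h ↦ ofZ (Q⁻ᵀ Z(h) Q⁻¹)` (Klingen I.1 (5)). [folklore] -/
def derivL (g : Sp4R) (x : Fin 6 → ℝ) : (Fin 6 → ℝ) →L[ℝ] (Fin 6 → ℝ) :=
  ofZL.comp ((ContinuousLinearMap.mulLeftRight ℝ (Matrix (Fin 2) (Fin 2) ℂ)
    ((matQ g x)ᵀ)⁻¹ (matQ g x)⁻¹).comp toZL)

/-- `derivL` applied. [folklore] -/
theorem derivL_apply (g : Sp4R) (x h : Fin 6 → ℝ) :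
    derivL g x h = ofZ (((matQ g x)ᵀ)⁻¹ * toZ h * (matQ g x)⁻¹) := rfl

/-- **`x ↦ g • x` is differentiable on `H₂` with derivative `derivL g x`.** [folklore] -/
theorem hasFDerivAt_smulVec (hx : x ∈ U) : HasFDerivAt (smulVec g) (derivL g x) x := by
  have hP := hasFDerivAt_matP g x
  have hQ := hasFDerivAt_matQ_inv g hx
  have hmul := hP.mul' hQ
  have hZ : HasFDerivAt (smulZ g) _ x := hmul
  have hV : HasFDerivAt (smulVec g) (ofZL.comp _) x := ofZL.hasFDerivAt.comp x hZ
  refine hV.congr_fderiv ?_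
  ext h : 1
  change ofZ (matP g x * -((matQ g x)⁻¹ * (cC g * toZ h) * (matQ g x)⁻¹) + cA g * toZ h * (matQ g x)⁻¹) =
    ofZ (((matQ g x)ᵀ)⁻¹ * toZ h * (matQ g x)⁻¹)
  congr 1
  rw [← cA_sub_smulZ_mul_cC g hx]
  simp only [smulZ]
  noncomm_ring

end Deriv

/-! ### The Jacobian determinant `|det Q|⁻⁶` -/

section Jacobian

/-- `ℝ⁶ ≃ ℂ³`, `x ↦ (x₀ + i x₃, x₁ + i x₄, x₂ + i x₅)` (the complex coordinates `z₁₁, z₁₂, z₂₂`). [folklore] -/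
def cplx : (Fin 6 → ℝ) ≃ₗ[ℝ] (Fin 3 → ℂ) where
  toFun x := ![(x 0 : ℂ) + x 3 * I, (x 1 : ℂ) + x 4 * I, (x 2 : ℂ) + x 5 * I]
  invFun z := ![(z 0).re, (z 1).re, (z 2).re, (z 0).im, (z 1).im, (z 2).im]
  map_add' x y := by ext i; fin_cases i <;> simp <;> ring
  map_smul' c x := by ext i; fin_cases i <;> simp <;> ring
  left_inv x := by ext i; fin_cases i <;> simp
  right_inv z := by
    ext i; fin_cases i <;> apply Complex.ext <;> simp

/-- The matrix of `H ↦ Rᵀ H R` on `Sym₂(ℂ)` in the basis `E₁₁, E₁₂ + E₂₁, E₂₂`. [folklore] -/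
def symSq (R : Matrix (Fin 2) (Fin 2) ℂ) : Matrix (Fin 3) (Fin 3) ℂ :=
  !![R 0 0 ^ 2, 2 * R 0 0 * R 1 0, R 1 0 ^ 2;
     R 0 0 * R 0 1, R 0 0 * R 1 1 + R 1 0 * R 0 1, R 1 0 * R 1 1;
     R 0 1 ^ 2, 2 * R 0 1 * R 1 1, R 1 1 ^ 2]

/-- `det symSq R = (det R)³`. [folklore] -/
theorem det_symSq (R : Matrix (Fin 2) (Fin 2) ℂ) : (symSq R).det = R.det ^ 3 := by
  simp [symSq, Matrix.det_fin_three, Matrix.det_fin_two]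
  ring

/-- The sandwich map in coordinates: `ofZ (Rᵀ Z(h) R) = cplx⁻¹ (symSq R · cplx h)`. [folklore] -/
theorem ofZ_sandwich (R : Matrix (Fin 2) (Fin 2) ℂ) (h : Fin 6 → ℝ) :
    ofZ (Rᵀ * toZ h * R) = cplx.symm (symSq R *ᵥ cplx h) := by
  have e : ∀ i j : Fin 2, (Rᵀ * toZ h * R) i j =
      (symSq R *ᵥ cplx h) (if i = 0 ∧ j = 0 then 0 else if i = 1 ∧ j = 1 then 2 else 1) := by
    intro i j
    fin_cases i <;> fin_cases j <;>
      simp [Matrix.mul_apply, Fin.sum_univ_two, toZ, symSq, Matrix.mulVec, dotProduct,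
        Fin.sum_univ_three, cplx] <;> ring
  ext k
  fin_cases k <;> simp [ofZ, cplx, e]

/-- `derivL` is conjugate to the complex-linear map `symSq (Q⁻¹)`. [folklore] -/
theorem derivL_eq_conj (g : Sp4R) (x : Fin 6 → ℝ) :
    (derivL g x : (Fin 6 → ℝ) →ₗ[ℝ] (Fin 6 → ℝ)) =
      (cplx.symm : (Fin 3 → ℂ) ≃ₗ[ℝ] (Fin 6 → ℝ)).toLinearMap ∘ₗ
        ((Matrix.toLin' (symSq (matQ g x)⁻¹)).restrictScalars ℝ) ∘ₗ
        (cplx.symm : (Fin 3 → ℂ) ≃ₗ[ℝ] (Fin 6 → ℝ)).symm.toLinearMap := by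
  apply LinearMap.ext
  intro h
  simp only [ContinuousLinearMap.coe_coe, derivL_apply, LinearMap.coe_comp, Function.comp_apply,
    LinearEquiv.coe_toLinearMap, LinearEquiv.symm_symm, LinearMap.coe_restrictScalars,
    Matrix.toLin'_apply]
  rw [← transpose_nonsing_inv, ofZ_sandwich]

/-- **The Jacobian determinant of `x ↦ g • x` is `|det(CZ + D)|⁻⁶`** (Klingen I.1:
`det ∂(x*, y*)/∂(x, y) = |det(cz + d)|^{-2n-2}`, `n = 2`). [cite: Klingen1990, Ch. I §1, after (5)] -/
theorem det_derivL (hx : x ∈ U) :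
    (derivL g x).det = ((Complex.normSq (matQ g x).det) ^ 3)⁻¹ := by
  have hdet := det_matQ_ne_zero g hx
  rw [ContinuousLinearMap.det, derivL_eq_conj, LinearMap.det_conj, LinearMap.det_restrictScalars,
    LinearMap.det_toLin', det_symSq, Matrix.det_nonsing_inv, Algebra.norm_complex_apply,
    Ring.inverse_eq_inv', map_pow, map_inv₀, inv_pow]

end Jacobian

/-! ### The symplectic volume `dx dy / det y³` on `H₂` and its invariance -/

section Volume

open MeasureTheory Set

/-- `H₂` is open in `ℝ⁶`. [folklore] -/
theorem isOpen_U : IsOpen U := by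
  have : U = {x : Fin 6 → ℝ | 0 < x 3} ∩ {x | x 4 ^ 2 < x 3 * x 5} := rfl
  rw [this]
  exact (isOpen_lt continuous_const (continuous_apply 3)).inter
    (isOpen_lt (by fun_prop) (by fun_prop))

/-- `H₂` is measurable. [folklore] -/
theorem measurableSet_U : MeasurableSet U := isOpen_U.measurableSet

/-- The inclusion `H₂ ⊂ ℝ⁶` is a measurable embedding. [folklore] -/
theorem measurableEmbedding_val : MeasurableEmbedding ((↑) : U → Fin 6 → ℝ) :=
  MeasurableEmbedding.subtype_coe measurableSet_U

/-- `x ↦ g • x` is continuous on `H₂`. [folklore] -/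
theorem continuousOn_smulVec (g : Sp4R) : ContinuousOn (smulVec g) U := fun _ hx =>
  (hasFDerivAt_smulVec g hx).continuousAt.continuousWithinAt

/-- `p ↦ g • p` is continuous on the subtype. [folklore] -/
theorem continuous_smul_U (g : Sp4R) : Continuous (fun p : U => (g • p : U)) := by
  have h : Continuous (fun p : U => smulVec g p.1) :=
    (continuousOn_iff_continuous_restrict.1 (continuousOn_smulVec g))
  exact h.subtype_mk _

/-- The action is measurable. [folklore] -/
instance instMeasurableConstSMulU : MeasurableConstSMul Sp4R U :=
  ⟨fun g => (continuous_smul_U g).measurable⟩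

/-- The density `det(y)⁻³`. [folklore] -/
def density (x : Fin 6 → ℝ) : ℝ := ((x 3 * x 5 - x 4 ^ 2)⁻¹) ^ 3

/-- The density is measurable. [folklore] -/
theorem measurable_density : Measurable density := by unfold density; fun_prop

/-- **The symplectic volume `dv = dx dy / det y³` on `H₂`** (Klingen I.1, after (7)), as a measure
on the subtype `↥U`. [folklore] -/
def siegelVolume : Measure U :=
  (volume.comap ((↑) : U → Fin 6 → ℝ)).withDensity fun p => ENNReal.ofReal (density p.1)

/-- The symplectic volume of a measurable set as a Lebesgue integral over its image in `ℝ⁶`. [folklore] -/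
theorem siegelVolume_eq_lintegral {s : Set U} (hs : MeasurableSet s) :
    siegelVolume s = ∫⁻ x in ((↑) : U → Fin 6 → ℝ) '' s, ENNReal.ofReal (density x) := by
  have hmp : MeasurePreserving ((↑) : U → Fin 6 → ℝ) (volume.comap ((↑) : U → Fin 6 → ℝ))
      (volume.restrict (range ((↑) : U → Fin 6 → ℝ))) :=
    ⟨measurable_subtype_coe, by rw [measurableEmbedding_val.map_comap]⟩
  rw [siegelVolume, withDensity_apply _ hs,
    ← Set.inter_eq_self_of_subset_left (Set.image_subset_range _ _),
    ← Measure.restrict_restrict' measurableEmbedding_val.measurableSet_range,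
    ← hmp.setLIntegral_comp_emb measurableEmbedding_val]

/-- The density transforms by the inverse Jacobian: `|det D(g•)(x)| · ρ(g • x) = ρ(x)`. [folklore] -/
theorem abs_det_derivL_mul_density (hx : x ∈ U) :
    |(derivL g x).det| * density (smulVec g x) = density x := by
  have hdet := det_matQ_ne_zero g hx
  have hn : 0 < Complex.normSq (matQ g x).det := Complex.normSq_pos.2 hdet
  have hD : 0 < x 3 * x 5 - x 4 ^ 2 := by have := hx.2; linarith
  rw [det_derivL g hx, density, density, detY_smulVec g hx, abs_of_pos (by positivity)]
  field_simp

/-- **`Sp₄(ℝ)` preserves the symplectic volume** (Klingen I.1: `dv_n` is invariant).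
[cite: Klingen1990, Ch. I §1, after (7)] -/
instance instSMulInvariantMeasureU : SMulInvariantMeasure Sp4R U siegelVolume := by
  refine ((smulInvariantMeasure_tfae Sp4R siegelVolume).out 2 0).mp fun g s hs => ?_
  rw [siegelVolume_eq_lintegral (hs.const_smul g), siegelVolume_eq_lintegral hs, ← Set.image_smul,
    Set.image_image]
  simp only [smul_coe]
  rw [← Set.image_image (smulVec g) ((↑) : U → Fin 6 → ℝ)]
  have hT : MeasurableSet (((↑) : U → Fin 6 → ℝ) '' s) :=
    measurableEmbedding_val.measurableSet_image.mpr hs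
  have hTU : ((↑) : U → Fin 6 → ℝ) '' s ⊆ U := by
    rintro _ ⟨p, -, rfl⟩; exact p.2
  have hinj : Set.InjOn (smulVec g) (((↑) : U → Fin 6 → ℝ) '' s) := by
    rintro _ ⟨p, -, rfl⟩ _ ⟨q, -, rfl⟩ h
    have : g • p = g • q := Subtype.ext h
    exact congrArg Subtype.val (smul_left_cancel g this)
  rw [lintegral_image_eq_lintegral_abs_det_fderiv_mul volume hT
    (fun y hy => (hasFDerivAt_smulVec g (hTU hy)).hasFDerivWithinAt) hinj]
  apply setLIntegral_congr_fun hT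
  intro y hy
  simp only
  rw [← ENNReal.ofReal_mul (abs_nonneg _), abs_det_derivL_mul_density g (hTU hy)]

end Volume

end Literature.NumberTheory.ModularForms.Sp4Covolume
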